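import Summits.SmoothPoincare4.SmoothPoincare4.Theses.SymplecticOrigami
import Literature.Topology.FourManifolds.HomotopySpheres
import Literature.Topology.FourManifolds.Diffeotopy

/-!
# Birth skeleton of piece X₃ `StableSeamRigidity` (split of crux `OrigamiFoldExistence`, stmt-SmoothPoincare4-7844)

X₃ = a homotopy 4-sphere `S` whose fake ball sits (`J`) in a closed simply connected uniruled
symplectic host `(X, Ω)` with Ω-STABLE seam (stabilising `θ`) is diffeomorphic to `S⁴` — the
RIGID, load-bearing half of the zero slack; verbatim the registered `stub_stableSeamRigidity`.
Write `σ` for the seam trace and `dθ|_TS³ = f · σ|_TS³` (`ker σ ⊂ ker dθ`, `σ` of rank 2 on `u^⊥`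
— landed `helper_seamTrace_rank`, p141486 — so `f : S³ → ℝ` is well defined and smooth; it is the
Cieliebak–Volkov / Cardona first integral of the characteristic flow, constant `≠ 0` exactly on
the contact regions; `f ≡ 0` is impossible on `S³` by Stokes).  In the chart, the SIGN of `f(u)`
is the sign of `dθ_u(v,w) · σ_u(v,w)` for tangent `v, w ⊥ u` (`= f(u) σ_u(v,w)²`), which is what the
stubs quantify — no orientation convention is needed for the case split.

PLAN = the case analysis the Cieliebak–Volkov structure theorem organises (CV 2015 Thm 1.8;
CALIBRATION-c8 §6 "FEF for stable seams splits as positive-contact / integrable /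
negative-contact regions"), cut at the one place where the known rung ends:
* `stub_semidefiniteSeamRigidity` [SEMI-DEFINITE SEAMS: `f` does not change sign ⇒ `S ≅ S⁴`;
  a theorem-sized rung over printed theorems, L–XL] — normalise `θ` positive for the boundary
  orientation of `W := J(Δ_e)` (possible: `θ ∧ σ` and the Ω-Pfaffian never vanish, `S³` is
  connected).  (i) `f ≥ 0` (`f ≢ 0`): `ker θ` is a positive CONFOLIATION (`θ ∧ dθ = f θ ∧ σ ≥ 0`),
  contact on `{f > 0} ≠ ∅`, hence C⁰-approximable by a positive contact structure `ξ'`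
  (Eliashberg–Thurston 1998, Ch. 2 §§2.8–2.9); `σ|_{ker θ} > 0` is open, so `Ω|_{ξ'} > 0`: `(W, Ω)` is
  a WEAK symplectic filling of `(S³, ξ')` ⇒ `ξ'` tight (Gromov–Eliashberg) ⇒ `ξ' ≅ ξ_st`
  (Eliashberg 1992) ⇒ `W ≅ B⁴ # k ℂℙ²bar` (Eliashberg 1990 Thm 5.1) ⇒ `k = 0` (`H₂(W) = 0`) ⇒
  `Δ_e ≅ B⁴` ⇒ `S ≅ S⁴` (Cerf `Γ₄ = 0`, route item `CerfGammaFour`) — lead c9's "sub-contact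
  criterion" made unconditional in the semi-positive case.  (ii) `f ≤ 0`: the same argument from
  the COMPLEMENT `C := X ∖ W̊` (for which `−θ` is positive and `−f ≥ 0`) makes `C` a weak filling of
  the standard `S³`, so `C ≅ B⁴ # k ℂℙ²bar` and `H₂(X) = H₂(C)` is NEGATIVE DEFINITE — impossible in
  the presence of the square-zero symplectic sphere `c` (`[c] ≠ 0`, `[c]² = 0`): the uniruledness
  witness is load-bearing here.  Why it might fail: only formally (every input is a printed
  theorem; the confoliation step needs ET's C² hypotheses, which hold).
* `stub_mixedSeamRigidity` [MIXED SEAMS: `f` changes sign ⇒ `S ≅ S⁴`; OPEN — the research stub,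
  = lead c9's "first research rung: f changes sign"] — engine (CALIBRATION-c8 §§0–2): FEF (a
  positive planar finite-energy foliation of the seam's symplectisation, from the host's GW-spheres
  by neck-stretching along the stable seam — BEHWZ 2003 compactness — or intrinsically) + Wendl's
  sweep-out recogniser transferred to stable Hamiltonian ends (T7-SHS, bookkeeping over printed
  theorems) ⇒ `W ≅ B⁴`; bench with known answer: the Chekanov / Cieliebak–Volkov exotic ball (a
  GENUINE `B⁴` whose stable boundary is mixed, `w(h) = −1`, with no cobordism to any contact-
  dominating form, CV 2015 Prop 7.15 / Cor 7.17) — it carries an explicit positive planar FEF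
  (criterion F4 of CALIBRATION-c8 §5), so the mechanism survives the bench.  Every witness of an
  exotic `S⁴` inside X₂ is a mixed seam (worker B, CALIBRATION-c8 §6), so this stub is where the
  zero slack of the crux now sits.  Why it might fail: unprovable rather than false (shielded: a
  counterexample is an exotic `S⁴`); the mechanism dies if finite-energy planes crossing
  negative-contact regions / invariant tori cannot be organised into a foliation (CV Thm 1.9/1.15).
* Composition `StableSeamRigidity_of` — excluded middle on "mixed".

BC3 probes (bc/StableSeamRigidity_birth_probe.lean): neither stub gives X₃ or SmoothPoincare4 under
`exact? | aesop` (each is X₃ restricted to one side of a non-trivial dichotomy).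
-/

noncomputable section

-- the prescribed namespace `Summit.<P>.<Sub>.…` duplicates `SmoothPoincare4` (P = Sub)
set_option linter.dupNamespace false

open scoped Manifold ContDiff Topology RealInnerProductSpace
open Set Function TopologicalSpace ContinuousMap

/-! ### The piece(s), declared LOCALLY in the route namespace exactly as the gate will render them
after `route edit --split` (pre-split draft; the published version imports the route file instead) -/

namespace Summit.SmoothPoincare4.SmoothPoincare4.Theses.SymplecticOrigami

/-- piece StableSeamRigidity (= registered `stub_stableSeamRigidity` of line stable-seam-host, verbatim). -/
def StableSeamRigidity : Prop :=
  ∀ (S : Literature.Topology.FourManifolds.HomotopySphere 4) (e : EuclideanSpace ℝ (Fin 4) → S.carrier) (X : Type) [TopologicalSpace X] [T2Space X] [SecondCountableTopology X] [CompactSpace X] [ChartedSpace (EuclideanSpace ℝ (Fin 4)) X] [IsManifold (𝓡 4) ∞ X] [SimplyConnectedSpace X] (Ω : Literature.Geometry.Kaehler.MForm (𝓡 4) X ℝ 2) (J : S.carrier → X) (c c' : (Metric.sphere (0 : EuclideanSpace ℝ (Fin 3)) 1) → X) (θ : EuclideanSpace ℝ (Fin 4) → EuclideanSpace ℝ (Fin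 4) →L[ℝ] ℝ), Manifold.IsSmoothEmbedding (𝓡 4) (𝓡 4) ∞ e → (Literature.Geometry.Kaehler.IsSmoothForm Ω ∧ Literature.Geometry.Kaehler.IsClosedForm Ω ∧ ∀ x (v : TangentSpace (𝓡 4) x), v ≠ 0 → ∃ w, Ω x ![v, w] ≠ 0) → (∃ U : Set S.carrier, IsOpen U ∧ (e '' Metric.ball (0 : EuclideanSpace ℝ (Fin 4)) 1)ᶜ ⊆ U ∧ ContMDiffOn (𝓡 4) (𝓡 4) ∞ J U ∧ Set.InjOn J U ∧ ∀ x ∈ U, Function.Bijective (mfderiv (𝓡 4) (𝓡 4) J x)) → (Manifold.IsSmoothEmbedding (𝓡 2) (𝓡 4) ∞ c ∧ (∀ y (v : TangentSpace (𝓡 2) y), v ≠ 0 → ∃ w : TangentSpace (𝓡 2) y, Ω (c y) ![mfderiv (𝓡 2) (𝓡 4) c y v, mfderiv (𝓡 2) (𝓡 4) c y w] ≠ 0) ∧ Manifold.IsSmoothEmbedding (𝓡 2) (𝓡 4) ∞ c' ∧ Disjoint (Set.range c) (Set.range c') ∧ ∃ H : unitInterval × (Metric.sphere (0 : EuclideanSpace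 ℝ (Fin 3)) 1) → X, Continuous H ∧ ∀ y, H (0, y) = c y ∧ H (1, y) = c' y) → (ContDiff ℝ ∞ θ ∧ (∀ u : EuclideanSpace ℝ (Fin 4), ‖u‖ = 1 → ∀ v : Fin 3 → EuclideanSpace ℝ (Fin 4), (∀ i, ⟪v i, u⟫ = 0) → LinearIndependent ℝ v → θ u (v 0) * Ω ((J ∘ e) u) ![mfderiv (𝓡 4) (𝓡 4) (J ∘ e) u (v 1), mfderiv (𝓡 4) (𝓡 4) (J ∘ e) u (v 2)] - θ u (v 1) * Ω ((J ∘ e) u) ![mfderiv (𝓡 4) (𝓡 4) (J ∘ e) u (v 0), mfderiv (𝓡 4) (𝓡 4) (J ∘ e) u (v 2)] + θ u (v 2) * Ω ((J ∘ e) u) ![mfderiv (𝓡 4) (𝓡 4) (J ∘ e) u (v 0), mfderiv (𝓡 4) (𝓡 4) (J ∘ e) u (v 1)] ≠ 0) ∧ (∀ u : EuclideanSpace ℝ (Fin 4), ‖u‖ = 1 → ∀ v : EuclideanSpace ℝ (Fin 4), ⟪v, u⟫ = 0 → (∀ w : EuclideanSpace ℝ (Fin 4), ⟪w, u⟫ =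 0 → Ω ((J ∘ e) u) ![mfderiv (𝓡 4) (𝓡 4) (J ∘ e) u v, mfderiv (𝓡 4) (𝓡 4) (J ∘ e) u w] = 0) → ∀ w : EuclideanSpace ℝ (Fin 4), ⟪w, u⟫ = 0 → fderiv ℝ θ u v w - fderiv ℝ θ u w v = 0)) → Nonempty (S.carrier ≃ₘ⟮𝓡 4, 𝓡 4⟯ Metric.sphere (0 : EuclideanSpace ℝ (Fin 5)) 1)

end Summit.SmoothPoincare4.SmoothPoincare4.Theses.SymplecticOrigami

namespace Summit.SmoothPoincare4.SmoothPoincare4.Cruxes.StableSeamRigidity.Birth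

open Summit.SmoothPoincare4.SmoothPoincare4.Theses.SymplecticOrigami (StableSeamRigidity)

/-- Statement of stub 1 [semi-definite seams bound balls]. -/
def SemidefiniteSeamRigidity : Prop :=
  ∀ (S : Literature.Topology.FourManifolds.HomotopySphere 4) (e : EuclideanSpace ℝ (Fin 4) → S.carrier) (X : Type) [TopologicalSpace X] [T2Space X] [SecondCountableTopology X] [CompactSpace X] [ChartedSpace (EuclideanSpace ℝ (Fin 4)) X] [IsManifold (𝓡 4) ∞ X] [SimplyConnectedSpace X] (Ω : Literature.Geometry.Kaehler.MForm (𝓡 4) X ℝ 2) (J : S.carrier → X) (c c' : (Metric.sphere (0 : EuclideanSpace ℝ (Fin 3)) 1) → X) (θ : EuclideanSpace ℝ (Fin 4) → EuclideanSpace ℝ (Fin 4) →L[ℝ] ℝ), Manifold.IsSmoothEmbedding (𝓡 4) (𝓡 4) ∞ e → (Literature.Geometry.Kaehler.IsSmoothForm Ω ∧ Literature.Geometry.Kaehler.IsClosedForm Ω ∧ ∀ x (v : TangentSpace (𝓡 4) x), v ≠ 0 → ∃ w, Ω x ![v, w] ≠ 0) → (∃ U : Set S.carrier, IsOpen U ∧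 (e '' Metric.ball (0 : EuclideanSpace ℝ (Fin 4)) 1)ᶜ ⊆ U ∧ ContMDiffOn (𝓡 4) (𝓡 4) ∞ J U ∧ Set.InjOn J U ∧ ∀ x ∈ U, Function.Bijective (mfderiv (𝓡 4) (𝓡 4) J x)) → (Manifold.IsSmoothEmbedding (𝓡 2) (𝓡 4) ∞ c ∧ (∀ y (v : TangentSpace (𝓡 2) y), v ≠ 0 → ∃ w : TangentSpace (𝓡 2) y, Ω (c y) ![mfderiv (𝓡 2) (𝓡 4) c y v, mfderiv (𝓡 2) (𝓡 4) c y w] ≠ 0) ∧ Manifold.IsSmoothEmbedding (𝓡 2) (𝓡 4) ∞ c' ∧ Disjoint (Set.range c) (Set.range c') ∧ ∃ H : unitInterval × (Metric.sphere (0 : EuclideanSpace ℝ (Fin 3)) 1) → X, Continuous H ∧ ∀ y, H (0, y) = c y ∧ H (1, y) = c' y) → (ContDiff ℝ ∞ θ ∧ (∀ u : EuclideanSpace ℝ (Fin 4), ‖u‖ = 1 → ∀ v : Fin 3 → EuclideanSpace ℝ (Fin 4), (∀ i, ⟪v i, u⟫ = 0) → LinearIndependent ℝ v → θ u (v 0)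 * Ω ((J ∘ e) u) ![mfderiv (𝓡 4) (𝓡 4) (J ∘ e) u (v 1), mfderiv (𝓡 4) (𝓡 4) (J ∘ e) u (v 2)] - θ u (v 1) * Ω ((J ∘ e) u) ![mfderiv (𝓡 4) (𝓡 4) (J ∘ e) u (v 0), mfderiv (𝓡 4) (𝓡 4) (J ∘ e) u (v 2)] + θ u (v 2) * Ω ((J ∘ e) u) ![mfderiv (𝓡 4) (𝓡 4) (J ∘ e) u (v 0), mfderiv (𝓡 4) (𝓡 4) (J ∘ e) u (v 1)] ≠ 0) ∧ (∀ u : EuclideanSpace ℝ (Fin 4), ‖u‖ = 1 → ∀ v : EuclideanSpace ℝ (Fin 4), ⟪v, u⟫ = 0 → (∀ w : EuclideanSpace ℝ (Fin 4), ⟪w, u⟫ = 0 → Ω ((J ∘ e) u) ![mfderiv (𝓡 4) (𝓡 4) (J ∘ e) u v, mfderiv (𝓡 4) (𝓡 4) (J ∘ e) u w] = 0) → ∀ w : EuclideanSpace ℝ (Fin 4), ⟪w, u⟫ = 0 → fderiv ℝ θ u v w - fderiv ℝ θ u w v = 0)) → ¬ ((∃ u : EuclideanSpace ℝ (Fin 4),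 ‖u‖ = 1 ∧ ∃ v w : EuclideanSpace ℝ (Fin 4), ⟪v, u⟫ = 0 ∧ ⟪w, u⟫ = 0 ∧ 0 < (fderiv ℝ θ u v w - fderiv ℝ θ u w v) * Ω ((J ∘ e) u) ![mfderiv (𝓡 4) (𝓡 4) (J ∘ e) u v, mfderiv (𝓡 4) (𝓡 4) (J ∘ e) u w]) ∧ (∃ u : EuclideanSpace ℝ (Fin 4), ‖u‖ = 1 ∧ ∃ v w : EuclideanSpace ℝ (Fin 4), ⟪v, u⟫ = 0 ∧ ⟪w, u⟫ = 0 ∧ (fderiv ℝ θ u v w - fderiv ℝ θ u w v) * Ω ((J ∘ e) u) ![mfderiv (𝓡 4) (𝓡 4) (J ∘ e) u v, mfderiv (𝓡 4) (𝓡 4) (J ∘ e) u w] < 0)) → Nonempty (S.carrier ≃ₘ⟮𝓡 4, 𝓡 4⟯ Metric.sphere (0 : EuclideanSpace ℝ (Fin 5)) 1)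

/-- Statement of stub 2 [mixed seams bound balls]. -/
def MixedSeamRigidity : Prop :=
  ∀ (S : Literature.Topology.FourManifolds.HomotopySphere 4) (e : EuclideanSpace ℝ (Fin 4) → S.carrier) (X : Type) [TopologicalSpace X] [T2Space X] [SecondCountableTopology X] [CompactSpace X] [ChartedSpace (EuclideanSpace ℝ (Fin 4)) X] [IsManifold (𝓡 4) ∞ X] [SimplyConnectedSpace X] (Ω : Literature.Geometry.Kaehler.MForm (𝓡 4) X ℝ 2) (J : S.carrier → X) (c c' : (Metric.sphere (0 : EuclideanSpace ℝ (Fin 3)) 1) → X) (θ : EuclideanSpace ℝ (Fin 4) → EuclideanSpace ℝ (Fin 4) →L[ℝ] ℝ), Manifold.IsSmoothEmbedding (𝓡 4) (𝓡 4) ∞ e → (Literature.Geometry.Kaehler.IsSmoothForm Ω ∧ Literature.Geometry.Kaehler.IsClosedForm Ω ∧ ∀ x (v : TangentSpace (𝓡 4) x), v ≠ 0 → ∃ w, Ω x ![v, w] ≠ 0) → (∃ U : Set S.carrier, IsOpen U ∧ (e '' Metric.ball (0 : EuclideanSpace ℝ (Fin 4)) 1)ᶜ ⊆ U ∧ ContMDiffOn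 (𝓡 4) (𝓡 4) ∞ J U ∧ Set.InjOn J U ∧ ∀ x ∈ U, Function.Bijective (mfderiv (𝓡 4) (𝓡 4) J x)) → (Manifold.IsSmoothEmbedding (𝓡 2) (𝓡 4) ∞ c ∧ (∀ y (v : TangentSpace (𝓡 2) y), v ≠ 0 → ∃ w : TangentSpace (𝓡 2) y, Ω (c y) ![mfderiv (𝓡 2) (𝓡 4) c y v, mfderiv (𝓡 2) (𝓡 4) c y w] ≠ 0) ∧ Manifold.IsSmoothEmbedding (𝓡 2) (𝓡 4) ∞ c' ∧ Disjoint (Set.range c) (Set.range c') ∧ ∃ H : unitInterval × (Metric.sphere (0 : EuclideanSpace ℝ (Fin 3)) 1) → X, Continuous H ∧ ∀ y, H (0, y) = c y ∧ H (1, y) = c' y) → (ContDiff ℝ ∞ θ ∧ (∀ u : EuclideanSpace ℝ (Fin 4), ‖u‖ = 1 → ∀ v : Fin 3 → EuclideanSpace ℝ (Fin 4), (∀ i, ⟪v i, u⟫ = 0) → LinearIndependent ℝ v → θ u (v 0) * Ω ((J ∘ e) u) ![mfderiv (𝓡 4) (𝓡 4) (J ∘ e) u (v 1), mfderiv (𝓡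 4) (𝓡 4) (J ∘ e) u (v 2)] - θ u (v 1) * Ω ((J ∘ e) u) ![mfderiv (𝓡 4) (𝓡 4) (J ∘ e) u (v 0), mfderiv (𝓡 4) (𝓡 4) (J ∘ e) u (v 2)] + θ u (v 2) * Ω ((J ∘ e) u) ![mfderiv (𝓡 4) (𝓡 4) (J ∘ e) u (v 0), mfderiv (𝓡 4) (𝓡 4) (J ∘ e) u (v 1)] ≠ 0) ∧ (∀ u : EuclideanSpace ℝ (Fin 4), ‖u‖ = 1 → ∀ v : EuclideanSpace ℝ (Fin 4), ⟪v, u⟫ = 0 → (∀ w : EuclideanSpace ℝ (Fin 4), ⟪w, u⟫ = 0 → Ω ((J ∘ e) u) ![mfderiv (𝓡 4) (𝓡 4) (J ∘ e) u v, mfderiv (𝓡 4) (𝓡 4) (J ∘ e) u w] = 0) → ∀ w : EuclideanSpace ℝ (Fin 4), ⟪w, u⟫ = 0 → fderiv ℝ θ u v w - fderiv ℝ θ u w v = 0)) → ((∃ u : EuclideanSpace ℝ (Fin 4), ‖u‖ = 1 ∧ ∃ v w : EuclideanSpace ℝ (Fin 4), ⟪v, u⟫ = 0 ∧ ⟪w,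 u⟫ = 0 ∧ 0 < (fderiv ℝ θ u v w - fderiv ℝ θ u w v) * Ω ((J ∘ e) u) ![mfderiv (𝓡 4) (𝓡 4) (J ∘ e) u v, mfderiv (𝓡 4) (𝓡 4) (J ∘ e) u w]) ∧ (∃ u : EuclideanSpace ℝ (Fin 4), ‖u‖ = 1 ∧ ∃ v w : EuclideanSpace ℝ (Fin 4), ⟪v, u⟫ = 0 ∧ ⟪w, u⟫ = 0 ∧ (fderiv ℝ θ u v w - fderiv ℝ θ u w v) * Ω ((J ∘ e) u) ![mfderiv (𝓡 4) (𝓡 4) (J ∘ e) u v, mfderiv (𝓡 4) (𝓡 4) (J ∘ e) u w] < 0)) → Nonempty (S.carrier ≃ₘ⟮𝓡 4, 𝓡 4⟯ Metric.sphere (0 : EuclideanSpace ℝ (Fin 5)) 1)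

/-- STUB 1 [SEMI-DEFINITE STABLE SEAMS BOUND BALLS] (theorem-sized rung over printed theorems;
L–XL formally).  Hypotheses of X₃ plus: the sign of `dθ · σ` on tangent pairs never takes both
signs over `S³` (`f ≥ 0` or `f ≤ 0`).  Proof plan: normalise `θ` positive w.r.t. `∂W`,
`W = J(Δ_e)`; `f ≥ 0` ⇒ positive confoliation, contact somewhere (`f ≡ 0` impossible by Stokes)
⇒ Eliashberg–Thurston perturbation to a positive contact `ξ'` with `Ω|_ξ' > 0` ⇒ weak filling ⇒
tight ⇒ standard ⇒ `W ≅ B⁴ # kℂℙ²bar`, `k = 0` ⇒ `S ≅ S⁴` (Cerf); `f ≤ 0` ⇒ the complement weakly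
fills the standard `S³` ⇒ `H₂(X)` negative definite, contradicting the square-zero symplectic
sphere `c`.  Sources: EliashbergThurston1998, Eliashberg1990, Eliashberg1992, Gromov1985,
McDuff1990, Cerf1968, arXiv:1003.5084. -/
theorem stub_semidefiniteSeamRigidity :
    ∀ (S : Literature.Topology.FourManifolds.HomotopySphere 4) (e : EuclideanSpace ℝ (Fin 4) → S.carrier) (X : Type) [TopologicalSpace X] [T2Space X] [SecondCountableTopology X] [CompactSpace X] [ChartedSpace (EuclideanSpace ℝ (Fin 4)) X] [IsManifold (𝓡 4) ∞ X] [SimplyConnectedSpace X] (Ω : Literature.Geometry.Kaehler.MForm (𝓡 4) X ℝ 2) (J : S.carrier → X) (c c' : (Metric.sphere (0 : EuclideanSpace ℝ (Fin 3)) 1) → X) (θ : EuclideanSpace ℝ (Fin 4) → EuclideanSpace ℝ (Fin 4) →L[ℝ] ℝ), Manifold.IsSmoothEmbedding (𝓡 4) (𝓡 4) ∞ e → (Literature.Geometry.Kaehler.IsSmoothForm Ω ∧ Literature.Geometry.Kaehler.IsClosedForm Ω ∧ ∀ x (v : TangentSpace (𝓡 4) x), v ≠ 0 → ∃ w, Ω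 x ![v, w] ≠ 0) → (∃ U : Set S.carrier, IsOpen U ∧ (e '' Metric.ball (0 : EuclideanSpace ℝ (Fin 4)) 1)ᶜ ⊆ U ∧ ContMDiffOn (𝓡 4) (𝓡 4) ∞ J U ∧ Set.InjOn J U ∧ ∀ x ∈ U, Function.Bijective (mfderiv (𝓡 4) (𝓡 4) J x)) → (Manifold.IsSmoothEmbedding (𝓡 2) (𝓡 4) ∞ c ∧ (∀ y (v : TangentSpace (𝓡 2) y), v ≠ 0 → ∃ w : TangentSpace (𝓡 2) y, Ω (c y) ![mfderiv (𝓡 2) (𝓡 4) c y v, mfderiv (𝓡 2) (𝓡 4) c y w] ≠ 0) ∧ Manifold.IsSmoothEmbedding (𝓡 2) (𝓡 4) ∞ c' ∧ Disjoint (Set.range c) (Set.range c') ∧ ∃ H : unitInterval × (Metric.sphere (0 : EuclideanSpace ℝ (Fin 3)) 1) → X, Continuous H ∧ ∀ y, H (0, y) = c y ∧ H (1, y) = c' y) → (ContDiff ℝ ∞ θ ∧ (∀ u : EuclideanSpace ℝ (Fin 4), ‖u‖ = 1 → ∀ v : Fin 3 → EuclideanSpace ℝ (Fin 4), (∀ i,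 ⟪v i, u⟫ = 0) → LinearIndependent ℝ v → θ u (v 0) * Ω ((J ∘ e) u) ![mfderiv (𝓡 4) (𝓡 4) (J ∘ e) u (v 1), mfderiv (𝓡 4) (𝓡 4) (J ∘ e) u (v 2)] - θ u (v 1) * Ω ((J ∘ e) u) ![mfderiv (𝓡 4) (𝓡 4) (J ∘ e) u (v 0), mfderiv (𝓡 4) (𝓡 4) (J ∘ e) u (v 2)] + θ u (v 2) * Ω ((J ∘ e) u) ![mfderiv (𝓡 4) (𝓡 4) (J ∘ e) u (v 0), mfderiv (𝓡 4) (𝓡 4) (J ∘ e) u (v 1)] ≠ 0) ∧ (∀ u : EuclideanSpace ℝ (Fin 4), ‖u‖ = 1 → ∀ v : EuclideanSpace ℝ (Fin 4), ⟪v, u⟫ = 0 → (∀ w : EuclideanSpace ℝ (Fin 4), ⟪w, u⟫ = 0 → Ω ((J ∘ e) u) ![mfderiv (𝓡 4) (𝓡 4) (J ∘ e) u v, mfderiv (𝓡 4) (𝓡 4) (J ∘ e) u w] = 0) → ∀ w : EuclideanSpace ℝ (Fin 4), ⟪w, u⟫ = 0 → fderiv ℝ θ u v w - fderiv ℝ θ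 u w v = 0)) → ¬ ((∃ u : EuclideanSpace ℝ (Fin 4), ‖u‖ = 1 ∧ ∃ v w : EuclideanSpace ℝ (Fin 4), ⟪v, u⟫ = 0 ∧ ⟪w, u⟫ = 0 ∧ 0 < (fderiv ℝ θ u v w - fderiv ℝ θ u w v) * Ω ((J ∘ e) u) ![mfderiv (𝓡 4) (𝓡 4) (J ∘ e) u v, mfderiv (𝓡 4) (𝓡 4) (J ∘ e) u w]) ∧ (∃ u : EuclideanSpace ℝ (Fin 4), ‖u‖ = 1 ∧ ∃ v w : EuclideanSpace ℝ (Fin 4), ⟪v, u⟫ = 0 ∧ ⟪w, u⟫ = 0 ∧ (fderiv ℝ θ u v w - fderiv ℝ θ u w v) * Ω ((J ∘ e) u) ![mfderiv (𝓡 4) (𝓡 4) (J ∘ e) u v, mfderiv (𝓡 4) (𝓡 4) (J ∘ e) u w] < 0)) → Nonempty (S.carrier ≃ₘ⟮𝓡 4, 𝓡 4⟯ Metric.sphere (0 : EuclideanSpace ℝ (Fin 5)) 1) := by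
  sorry

/-- STUB 2 [MIXED STABLE SEAMS BOUND BALLS] (open; the research stub — punctured holomorphic
curves).  Hypotheses of X₃ plus: `dθ · σ` takes both signs (the CV-function `f` changes sign: the
seam has both a positive- and a negative-contact region, glued along integrable `T² × I` regions,
CV 2015 Thm 1.8).  Engine: FEF + T7-SHS (CALIBRATION-c8 §§0–2, §5 F4), host GW-spheres stretched
along the stable seam (BEHWZ 2003), automatic transversality (Wendl 2010), Siefring intersection
theory; bench: the Cieliebak–Volkov exotic ball (genuine `B⁴`, mixed stable boundary, explicit
planar FEF).  Why it might fail: unprovable rather than false (shielded by SPC4); planes crossing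
`N⁻` / invariant tori may not organise into a foliation.  Sources: arXiv:1003.5084, BEHWZ2003
(arXiv:math/0308183), Wendl2010 (arXiv:0806.3193, arXiv:0802.3842), HWZ2003, Siefring2011,
HutchingsTaubes2009, McDuff1990, Cerf1968. -/
theorem stub_mixedSeamRigidity :
    ∀ (S : Literature.Topology.FourManifolds.HomotopySphere 4) (e : EuclideanSpace ℝ (Fin 4) → S.carrier) (X : Type) [TopologicalSpace X] [T2Space X] [SecondCountableTopology X] [CompactSpace X] [ChartedSpace (EuclideanSpace ℝ (Fin 4)) X] [IsManifold (𝓡 4) ∞ X] [SimplyConnectedSpace X] (Ω : Literature.Geometry.Kaehler.MForm (𝓡 4) X ℝ 2) (J : S.carrier → X) (c c' : (Metric.sphere (0 : EuclideanSpace ℝ (Fin 3)) 1) → X) (θ : EuclideanSpace ℝ (Fin 4) → EuclideanSpace ℝ (Fin 4) →L[ℝ] ℝ), Manifold.IsSmoothEmbedding (𝓡 4) (𝓡 4) ∞ e → (Literature.Geometry.Kaehler.IsSmoothForm Ω ∧ Literature.Geometry.Kaehler.IsClosedForm Ω ∧ ∀ x (v : TangentSpace (𝓡 4) x), v ≠ 0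 → ∃ w, Ω x ![v, w] ≠ 0) → (∃ U : Set S.carrier, IsOpen U ∧ (e '' Metric.ball (0 : EuclideanSpace ℝ (Fin 4)) 1)ᶜ ⊆ U ∧ ContMDiffOn (𝓡 4) (𝓡 4) ∞ J U ∧ Set.InjOn J U ∧ ∀ x ∈ U, Function.Bijective (mfderiv (𝓡 4) (𝓡 4) J x)) → (Manifold.IsSmoothEmbedding (𝓡 2) (𝓡 4) ∞ c ∧ (∀ y (v : TangentSpace (𝓡 2) y), v ≠ 0 → ∃ w : TangentSpace (𝓡 2) y, Ω (c y) ![mfderiv (𝓡 2) (𝓡 4) c y v, mfderiv (𝓡 2) (𝓡 4) c y w] ≠ 0) ∧ Manifold.IsSmoothEmbedding (𝓡 2) (𝓡 4) ∞ c' ∧ Disjoint (Set.range c) (Set.range c') ∧ ∃ H : unitInterval × (Metric.sphere (0 : EuclideanSpace ℝ (Fin 3)) 1) → X, Continuous H ∧ ∀ y, H (0, y) = c y ∧ H (1, y) = c' y) → (ContDiff ℝ ∞ θ ∧ (∀ u : EuclideanSpace ℝ (Fin 4), ‖u‖ = 1 → ∀ v : Fin 3 → EuclideanSpace ℝ (Fin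 4), (∀ i, ⟪v i, u⟫ = 0) → LinearIndependent ℝ v → θ u (v 0) * Ω ((J ∘ e) u) ![mfderiv (𝓡 4) (𝓡 4) (J ∘ e) u (v 1), mfderiv (𝓡 4) (𝓡 4) (J ∘ e) u (v 2)] - θ u (v 1) * Ω ((J ∘ e) u) ![mfderiv (𝓡 4) (𝓡 4) (J ∘ e) u (v 0), mfderiv (𝓡 4) (𝓡 4) (J ∘ e) u (v 2)] + θ u (v 2) * Ω ((J ∘ e) u) ![mfderiv (𝓡 4) (𝓡 4) (J ∘ e) u (v 0), mfderiv (𝓡 4) (𝓡 4) (J ∘ e) u (v 1)] ≠ 0) ∧ (∀ u : EuclideanSpace ℝ (Fin 4), ‖u‖ = 1 → ∀ v : EuclideanSpace ℝ (Fin 4), ⟪v, u⟫ = 0 → (∀ w : EuclideanSpace ℝ (Fin 4), ⟪w, u⟫ = 0 → Ω ((J ∘ e) u) ![mfderiv (𝓡 4) (𝓡 4) (J ∘ e) u v, mfderiv (𝓡 4) (𝓡 4) (J ∘ e) u w] = 0) → ∀ w : EuclideanSpace ℝ (Fin 4), ⟪w, u⟫ = 0 → fderiv ℝ θ u v w - fderiv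 ℝ θ u w v = 0)) → ((∃ u : EuclideanSpace ℝ (Fin 4), ‖u‖ = 1 ∧ ∃ v w : EuclideanSpace ℝ (Fin 4), ⟪v, u⟫ = 0 ∧ ⟪w, u⟫ = 0 ∧ 0 < (fderiv ℝ θ u v w - fderiv ℝ θ u w v) * Ω ((J ∘ e) u) ![mfderiv (𝓡 4) (𝓡 4) (J ∘ e) u v, mfderiv (𝓡 4) (𝓡 4) (J ∘ e) u w]) ∧ (∃ u : EuclideanSpace ℝ (Fin 4), ‖u‖ = 1 ∧ ∃ v w : EuclideanSpace ℝ (Fin 4), ⟪v, u⟫ = 0 ∧ ⟪w, u⟫ = 0 ∧ (fderiv ℝ θ u v w - fderiv ℝ θ u w v) * Ω ((J ∘ e) u) ![mfderiv (𝓡 4) (𝓡 4) (J ∘ e) u v, mfderiv (𝓡 4) (𝓡 4) (J ∘ e) u w] < 0)) → Nonempty (S.carrier ≃ₘ⟮𝓡 4, 𝓡 4⟯ Metric.sphere (0 : EuclideanSpace ℝ (Fin 5)) 1) := by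
  sorry

/-! ### Consistency: the named statements ARE the stubs -/

theorem semidefiniteSeamRigidity_holds : SemidefiniteSeamRigidity := stub_semidefiniteSeamRigidity
theorem mixedSeamRigidity_holds : MixedSeamRigidity := stub_mixedSeamRigidity

/-! ### Composition (pure logic, no `sorry`) -/

/-- `StableSeamRigidity` from the two stubs, BY NAME: excluded middle on "the seam is mixed". -/
theorem StableSeamRigidity_of (h1 : SemidefiniteSeamRigidity) (h2 : MixedSeamRigidity) :
    StableSeamRigidity := by
  intro S e X _ _ _ _ _ _ _ Ω J c c' θ he hΩ hJ hc hθ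
  exact (Classical.em _).elim (fun hm => h2 S e X Ω J c c' θ he hΩ hJ hc hθ hm)
    (fun hm => h1 S e X Ω J c c' θ he hΩ hJ hc hθ hm)

/-- Wiring check. -/
example : StableSeamRigidity := StableSeamRigidity_of stub_semidefiniteSeamRigidity stub_mixedSeamRigidity

/-- Sanity: the conclusion is inhabited at the round sphere. -/
example : Nonempty ((Metric.sphere (0 : EuclideanSpace ℝ (Fin 5)) 1) ≃ₘ⟮𝓡 4, 𝓡 4⟯ Metric.sphere (0 : EuclideanSpace ℝ (Fin 5)) 1) := ⟨Diffeomorph.refl _ _ _⟩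

end Summit.SmoothPoincare4.SmoothPoincare4.Cruxes.StableSeamRigidity.Birth

end
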